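import Summits.QuantumFields.BalabanUV.Beta.GAN24.ResponseResidueClassSums

/-!
# `BalabanUV.Beta.GAN24.PeriodicDataFaceSums` — binder row G-an2-4 ∕ (CONV-C), the (S) row ∕ (W-γ) one level up:
# **FOR BLOCK-PERIODIC DATA `n`, EVERY FACE SUM OF THE END-INSIDE ∕ BASE-OUTSIDE PARTIAL CONTOUR SUMS OF THE RESPONSE `H_j n` VANISHES** —
# `Σ_{r∈box, r_μ = c} EI_{Lc}(H_j n) μ (Lc•Y + r) = 0 = Σ_{r∈box, r_μ = c} BO_{Lc}(H_j n) μ (Lc•Y + r)`, `H_j n = Σ_l Σ'_t n(l,t)·colH G_j Lc l t`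
# (`Lc` odd, centred root, every `j`, every bounded `Lc`-periodic `n`, every `μ`, `Y`, `c < Lc`)
# (G-an2-4 CRUX TEAM (2), seat `b2b-balaban-gan24-formalise-leaf-06` = the (γ) hand, gen 49, FILE (δ2a))

NOT IN PRINT; OUR BOOKKEEPING ([folklore] BY NAME: TODAY's FILE (δ1) `ResponseResidueClassSums.tsum_blockWeight_mul_EI_colH_eq_zero ∕ _BO_` (block-weighted sums of the partial contour sums
of ONE response column vanish — FILE F + the transverse flux lemma (γ)), leaf-02's periodisation `BiStencilZeroMode.tsum_mul_periodic` ∕ `tsum_eq_sum_box_tsum`, an4's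
`OneStepKernelFamily.colH_translate` with an2's `shiftK_coDressKBmAt_KInvStep`, road-P2's `CoarseGaugeSourceResponse.summable_source_colH`, an2's `SecondOrderSplitDecay.summable_colH_mul_bdd`;
0 `def`, 0 cited fact, 0 `def … : Prop`, 0 sorry).
HONEST FRAMING (cell contract, verbatim): «discharging `BetaPertH` makes Bałaban's UV stability UNCONDITIONAL — a real constructive-QFT result; it is NOT the continuum limit and NOT
the Clay problem.»  HONEST DEPENDENCY (verbatim): «continuum YM on T⁴ ⇐ BetaPertH ∧ nine spine estimates (0/9 proved); BetaPertH ⇐ (D1) ∧ (D4) ∧ CAP+tail; G-an2-4 gates asym,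
D1 and NE2/3/4.»

WHY (R1 [GAN24LEAF06-G49-R1] §(C), steps (iv)–(v)).  The defect `(C2′) = ⟨C_j h, dψ⊙(BO − EI)(H_j n)⟩` of the closed form of the (γ) source pairing one level up reduces — by (E3)
(`DataColumnCombRows` §3: `C_j h ∈ range 𝒬ᵀ` for two-level `h`) and FILE (α) applied on the next lattice — to FACE SUMS of `U = (BO − EI)(H_j n)` over the faces of the label
block; this file proves that for BLOCK-PERIODIC data `n` (period `Lc` on the data lattice: the class of the tower's explicit potential `n⋆` and of E29∕E30's «per» forms) every such face
sum vanishes, separately for `EI` and `BO` and for EVERY face position `c`: unfold `H_j n = Σ_l Σ'_t n(l,t)·colH G_j(l,t)`, periodise the data index (`t = Lc•z + ρ`,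
`n(l, Lc•z + ρ) = n(l, ρ)`), move the period translation onto the field leg (`colH(l, ρ + Lc•z)(μ, u) = colH(l, ρ)(μ, u − Lc•Lc•z)`) — the face `{Lc•Y + r : r_μ = c}` swept by all `z`
is the residue class `{w : w_μ ≡ c}` — and apply (δ1) to each column `colH G_j(l, ρ)`.  ENGINE E30 (kit j178097 … j178341): face sums of `(BO − EI)(H_0 n)` against `C_0 h` vanish to
1e-11 in D = 2, 3 for periodic `n`, not for generic `n`.
* §1 `summable_shift_colH` (a response column along an injective affine family of field points), `summable_abs_source_colH` (road-P2's source series, absolutely), `emod_coarse_add_box`.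
* §2 **`periodic_faceSum_eq_zero_of_blockWeight`** — the periodisation argument for ANY selection `P b s` of contour positions whose block-weighted single-column sums vanish
  (hypothesis `hP`, the shape of (δ1) §3); **`periodic_faceSum_EI_eq_zero`**, **`periodic_faceSum_BO_eq_zero`** — the instances (`hP` := (δ1)).
Asserts NO value of any resolvent column beyond FILE F + (γ); (C2′) itself is the next file; NOTHING of (W-γ) at levels ≥ 1 ∕ (S) discharged; NEVER «G-an2-4 closed» as (CONV-C);
NOT D1, NOT `BetaPertH`, NOT continuum, NOT Clay.  2026-08-23; no existing file touched.
-/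

noncomputable section

open Finset
open scoped BigOperators
open Literature.MathematicalPhysics.QuantumFieldTheory
open Literature.MathematicalPhysics.QuantumFieldTheory.Balaban1983to89
open Literature.MathematicalPhysics.QuantumFieldTheory.Balaban1983to89.Beta
open ExpKernelCalculus (Site MKer Decays)
open AffineAveraging (Form1 box toSite unitVec unitVec_apply)
open AveragingContoursRooted (ctrOff ctrOff_mem_box)
open OneStepKernelFamily (KInvStep colH colH_translate)
open Summit.QuantumFields.BalabanUV.Beta.AxialDressingRooted (coDressKBmAt decays_coDressKBmAt_KInvStep one_le_of_neZero shiftK_coDressKBmAt_KInvStep)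
open Summit.QuantumFields.BalabanUV.Beta.SecondOrderSplitDecay (summable_colH_mul_bdd)
open Summit.QuantumFields.BalabanUV.Beta.GAN24.BiStencilZeroMode (tsum_eq_sum_box_tsum tsum_mul_periodic)
open Summit.QuantumFields.BalabanUV.Beta.GAN24.CoarseGaugeSourceResponse (summable_source_colH)
open Summit.QuantumFields.BalabanUV.Beta.GAN24.ResponseResidueClassSums (tsum_blockWeight_mul_EI_colH_eq_zero tsum_blockWeight_mul_BO_colH_eq_zero)

namespace Summit.QuantumFields.BalabanUV.Beta.GAN24.PeriodicDataFaceSums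

variable {d : ℕ} {Lc : ℕ} [NeZero Lc]

/-! ## §1 Summabilities and one residue -/

/-- [folklore] A response column read along the injective affine family `z ↦ Lc•(Lc•z + r) + b + s•e_μ` of field points is summable in `z`. -/
theorem summable_shift_colH (j : ℕ) (l μ : Fin (d + 1)) (t : Site (d + 1)) (r b : Fin (d + 1) → ℕ) (s : ℕ) :
    Summable fun z : Site (d + 1) => colH (coDressKBmAt (toSite (ctrOff (d + 1) Lc)) Lc (KInvStep (d := d) Lc j)) Lc l t μ
      ((Lc : ℤ) • ((Lc : ℤ) • z + toSite r) + toSite b + (s : ℤ) • unitVec μ) := by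
  have hLc1 : 1 ≤ Lc := one_le_of_neZero Lc
  obtain ⟨δG, CG, hδG, hCG, hG⟩ := decays_coDressKBmAt_KInvStep (d := d) (ctrOff_mem_box (d := d + 1) hLc1) j
  have h1 : Summable fun u : Site (d + 1) => colH (coDressKBmAt (toSite (ctrOff (d + 1) Lc)) Lc (KInvStep (d := d) Lc j)) Lc l t μ u :=
    (summable_colH_mul_bdd (N := Lc) ⟨δG, CG, hδG, hCG, hG⟩ (T := fun _ => (1 : ℝ)) (B := 1) (fun _ => by simp) l t μ).congr fun u => by simp
  have hL : (Lc : ℤ) ≠ 0 := by exact_mod_cast NeZero.ne Lc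
  have hinj : Function.Injective fun z : Site (d + 1) => (Lc : ℤ) • ((Lc : ℤ) • z + toSite r) + toSite b + (s : ℤ) • unitVec μ := by
    intro z z' h
    have h' : ∀ i, (Lc : ℤ) * ((Lc : ℤ) * z i + (r i : ℤ)) + (b i : ℤ) + (s : ℤ) * unitVec μ i
        = (Lc : ℤ) * ((Lc : ℤ) * z' i + (r i : ℤ)) + (b i : ℤ) + (s : ℤ) * unitVec μ i := fun i => by
      have := congrFun h i
      simpa [AffineAveraging.toSite] using this
    funext i
    have := h' i
    have h2 : (Lc : ℤ) * ((Lc : ℤ) * z i) = (Lc : ℤ) * ((Lc : ℤ) * z' i) := by linarith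
    exact mul_left_cancel₀ hL (mul_left_cancel₀ hL h2)
  exact h1.comp_injective hinj

/-- [folklore] The SOURCE series of a response column is absolutely summable at every field point (road-P2's `summable_source_colH`; real series). -/
theorem summable_abs_source_colH (j : ℕ) (l μ : Fin (d + 1)) (u : Site (d + 1)) :
    Summable fun t : Site (d + 1) => |colH (coDressKBmAt (toSite (ctrOff (d + 1) Lc)) Lc (KInvStep (d := d) Lc j)) Lc l t μ u| :=
  (summable_source_colH (Lc := Lc) (ctrOff (d + 1) Lc) j l μ u).abs

omit [NeZero Lc] in
/-- [folklore] The `μ`-residue of a point `Lc•z + r` of block `z` (`r ∈ box`) is `r_μ`. -/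
theorem emod_coarse_add_box (z : Site (d + 1)) {r : Fin (d + 1) → ℕ} (hr : r ∈ box (d + 1) Lc) (μ : Fin (d + 1)) :
    ((Lc : ℤ) • z + toSite r) μ % (Lc : ℤ) = (r μ : ℤ) := by
  have hrμ : r μ < Lc := Finset.mem_range.1 (Fintype.mem_piFinset.1 hr μ)
  simp only [Pi.add_apply, Pi.smul_apply, smul_eq_mul, AffineAveraging.toSite]
  rw [add_comm, Int.add_mul_emod_self_left]
  exact Int.emod_eq_of_lt (by positivity) (by exact_mod_cast hrμ)

/-! ## §2 The face sums for block-periodic data -/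

/-- NOT IN PRINT; OUR BOOKKEEPING.  **THE PERIODISATION ARGUMENT** (`Lc ≥ 1`, centred root, every `j`; bounded `Lc`-periodic `n`; `μ`, `Y`, `c < Lc`; ANY decidable selection `P b s` of
contour positions): IF for every datum `(l, ρ)` and every bounded block weight `g` the block-weighted sum of the selected partial contour sum of the single column `colH G_j(l, ρ)`
vanishes (`hP` — the shape of (δ1) §3), THEN the face sum of the selected partial contour sum of `H_j n = Σ_l Σ'_t n l t·colH G_j(l,t)` over the face `{Lc•Y + r : r ∈ box, r_μ = c}`
vanishes. -/
theorem periodic_faceSum_eq_zero_of_blockWeight (j : ℕ) {n : Form1 (d + 1) ℝ} {Bn : ℝ} (hnB : ∀ l t, |n l t| ≤ Bn)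
    (hper : ∀ (l : Fin (d + 1)) (t z : Site (d + 1)), n l (t + (Lc : ℤ) • z) = n l t) (μ : Fin (d + 1)) (Y : Site (d + 1)) (c : ℕ)
    (P : (Fin (d + 1) → ℕ) → ℕ → Prop) [∀ b s, Decidable (P b s)]
    (hP : ∀ (l : Fin (d + 1)) (ρ : Fin (d + 1) → ℕ) (g : ℤ → ℝ) (B : ℝ), (∀ z, |g z| ≤ B) →
      ∑' w : Site (d + 1), g (w μ) * ∑ b ∈ box (d + 1) Lc, ∑ s ∈ Finset.range Lc,
        (if P b s then colH (coDressKBmAt (toSite (ctrOff (d + 1) Lc)) Lc (KInvStep (d := d) Lc j)) Lc l (toSite ρ) μ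
          ((Lc : ℤ) • w + toSite b + (s : ℤ) • unitVec μ) else 0) = 0) :
    ∑ r ∈ (box (d + 1) Lc).filter (fun r => r μ = c), ∑ b ∈ box (d + 1) Lc, ∑ s ∈ Finset.range Lc,
      (if P b s then
        (∑ l, ∑' t : Site (d + 1), n l t * colH (coDressKBmAt (toSite (ctrOff (d + 1) Lc)) Lc (KInvStep (d := d) Lc j)) Lc l t μ
          ((Lc : ℤ) • ((Lc : ℤ) • Y + toSite r) + toSite b + (s : ℤ) • unitVec μ)) else 0) = 0 := by
  classical
  have hLc1 : 1 ≤ Lc := one_le_of_neZero Lc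
  have hBn : 0 ≤ Bn := (abs_nonneg _).trans (hnB 0 0)
  set G := coDressKBmAt (toSite (ctrOff (d + 1) Lc)) Lc (KInvStep (d := d) Lc j) with hGdef
  set pt : (Fin (d + 1) → ℕ) → (Fin (d + 1) → ℕ) → ℕ → Site (d + 1) → Site (d + 1) :=
    fun r b s Z => (Lc : ℤ) • ((Lc : ℤ) • Z + toSite r) + toSite b + (s : ℤ) • unitVec μ with hpt
  -- the selected single-column term, as a function of (datum t, block Z)
  set X : Fin (d + 1) → (Fin (d + 1) → ℕ) → (Fin (d + 1) → ℕ) → ℕ → Site (d + 1) → Site (d + 1) → ℝ :=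
    fun l r b s t Z => if P b s then colH G Lc l t μ (pt r b s Z) else 0 with hX
  -- summability in the source index
  have hXs : ∀ l r b s, Summable fun t : Site (d + 1) => n l t * X l r b s t Y := by
    intro l r b s
    by_cases h : P b s
    · simp only [hX, if_pos h]
      exact Summable.of_norm_bounded ((summable_abs_source_colH j l μ (pt r b s Y)).mul_left Bn) fun t => by
        rw [Real.norm_eq_abs, abs_mul]; exact mul_le_mul_of_nonneg_right (hnB l t) (abs_nonneg _)
    · simp only [hX, if_neg h, mul_zero]; exact summable_zero
  -- step A: the summand is `Σ_l Σ'_t n l t * X`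
  have eA : ∀ r b s, (if P b s then (∑ l, ∑' t : Site (d + 1), n l t * colH G Lc l t μ
        ((Lc : ℤ) • ((Lc : ℤ) • Y + toSite r) + toSite b + (s : ℤ) • unitVec μ)) else 0)
      = ∑ l, ∑' t : Site (d + 1), n l t * X l r b s t Y := by
    intro r b s
    by_cases h : P b s
    · simp only [hX, hpt, if_pos h]
    · simp only [hX, if_neg h, mul_zero, tsum_zero, Finset.sum_const_zero]
  rw [Finset.sum_congr rfl fun r _ => Finset.sum_congr rfl fun b _ => Finset.sum_congr rfl fun s _ => eA r b s]
  -- bring `Σ_l` outside and work per `l`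
  rw [show (∑ r ∈ (box (d + 1) Lc).filter (fun r => r μ = c), ∑ b ∈ box (d + 1) Lc, ∑ s ∈ Finset.range Lc, ∑ l, ∑' t : Site (d + 1), n l t * X l r b s t Y)
      = ∑ l, ∑ r ∈ (box (d + 1) Lc).filter (fun r => r μ = c), ∑ b ∈ box (d + 1) Lc, ∑ s ∈ Finset.range Lc, ∑' t : Site (d + 1), n l t * X l r b s t Y from by
    calc _ = ∑ r ∈ (box (d + 1) Lc).filter (fun r => r μ = c), ∑ b ∈ box (d + 1) Lc, ∑ l, ∑ s ∈ Finset.range Lc, ∑' t : Site (d + 1), n l t * X l r b s t Y :=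
          Finset.sum_congr rfl fun r _ => Finset.sum_congr rfl fun b _ => Finset.sum_comm
      _ = ∑ r ∈ (box (d + 1) Lc).filter (fun r => r μ = c), ∑ l, ∑ b ∈ box (d + 1) Lc, ∑ s ∈ Finset.range Lc, ∑' t : Site (d + 1), n l t * X l r b s t Y :=
          Finset.sum_congr rfl fun r _ => Finset.sum_comm
      _ = _ := Finset.sum_comm]
  refine Finset.sum_eq_zero fun l _ => ?_
  -- collect into one series
  have eB : (∑ r ∈ (box (d + 1) Lc).filter (fun r => r μ = c), ∑ b ∈ box (d + 1) Lc, ∑ s ∈ Finset.range Lc, ∑' t : Site (d + 1), n l t * X l r b s t Y)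
      = ∑' t : Site (d + 1), (∑ r ∈ (box (d + 1) Lc).filter (fun r => r μ = c), ∑ b ∈ box (d + 1) Lc, ∑ s ∈ Finset.range Lc, X l r b s t Y) * n l t := by
    symm
    rw [show (fun t : Site (d + 1) => (∑ r ∈ (box (d + 1) Lc).filter (fun r => r μ = c), ∑ b ∈ box (d + 1) Lc, ∑ s ∈ Finset.range Lc, X l r b s t Y) * n l t)
        = fun t => ∑ r ∈ (box (d + 1) Lc).filter (fun r => r μ = c), ∑ b ∈ box (d + 1) Lc, ∑ s ∈ Finset.range Lc, n l t * X l r b s t Y from by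
      funext t
      rw [Finset.sum_mul]
      refine Finset.sum_congr rfl fun r _ => ?_
      rw [Finset.sum_mul]
      refine Finset.sum_congr rfl fun b _ => ?_
      rw [Finset.sum_mul]
      exact Finset.sum_congr rfl fun s _ => mul_comm _ _]
    rw [Summable.tsum_finsetSum (fun r _ => summable_sum fun b _ => summable_sum fun s _ => hXs l r b s)]
    refine Finset.sum_congr rfl fun r _ => ?_
    rw [Summable.tsum_finsetSum (fun b _ => summable_sum fun s _ => hXs l r b s)]
    refine Finset.sum_congr rfl fun b _ => ?_
    exact Summable.tsum_finsetSum (fun s _ => hXs l r b s)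
  rw [eB]
  -- step B: periodise the data index
  have hsB : Summable fun t : Site (d + 1) => (∑ r ∈ (box (d + 1) Lc).filter (fun r => r μ = c), ∑ b ∈ box (d + 1) Lc, ∑ s ∈ Finset.range Lc, X l r b s t Y) * n l t := by
    have := summable_sum (s := (box (d + 1) Lc).filter (fun r => r μ = c)) fun r _ =>
      summable_sum (s := box (d + 1) Lc) fun b _ => summable_sum (s := Finset.range Lc) fun s _ => hXs l r b s
    refine this.congr fun t => ?_
    simp only [Finset.sum_mul]
    refine Finset.sum_congr rfl fun r _ => Finset.sum_congr rfl fun b _ => Finset.sum_congr rfl fun s _ => mul_comm _ _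
  rw [tsum_mul_periodic (N := Lc) (fun u z => hper l u z) hsB]
  refine Finset.sum_eq_zero fun ρ hρ => ?_
  -- step C: per residue class of the datum, the series over the period translations is a block-weighted single-column sum
  -- (i) move the translation onto the field leg
  have etr : ∀ (z : Site (d + 1)) r b s, X l r b s ((Lc : ℤ) • z + toSite ρ) Y = X l r b s (toSite ρ) (Y - z) := by
    intro z r b s
    simp only [hX]
    split_ifs with h
    · rw [add_comm ((Lc : ℤ) • z) (toSite ρ), hGdef,
        colH_translate (shiftK_coDressKBmAt_KInvStep (toSite (ctrOff (d + 1) Lc)) j) l (toSite ρ) ((Lc : ℤ) • z) μ]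
      congr 1
      simp only [hpt, smul_add, smul_sub]
      abel
    · rfl
  simp only [etr]
  -- (ii) reindex `z ↦ Y − z`
  have ere : (∑' z : Site (d + 1), ∑ r ∈ (box (d + 1) Lc).filter (fun r => r μ = c), ∑ b ∈ box (d + 1) Lc, ∑ s ∈ Finset.range Lc, X l r b s (toSite ρ) (Y - z))
      = ∑' z : Site (d + 1), ∑ r ∈ (box (d + 1) Lc).filter (fun r => r μ = c), ∑ b ∈ box (d + 1) Lc, ∑ s ∈ Finset.range Lc, X l r b s (toSite ρ) z := by
    rw [← (Equiv.subLeft Y).tsum_eq (fun z => ∑ r ∈ (box (d + 1) Lc).filter (fun r => r μ = c), ∑ b ∈ box (d + 1) Lc, ∑ s ∈ Finset.range Lc, X l r b s (toSite ρ) z)]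
    rfl
  rw [ere]
  -- (iii) the block weight `g = 𝟙[· % Lc = c]` and (δ1)'s shape
  set g : ℤ → ℝ := fun S => if S % (Lc : ℤ) = (c : ℤ) then 1 else 0 with hg
  have hgb : ∀ S, |g S| ≤ 1 := fun S => by simp only [hg]; split <;> simp
  have key := hP l ρ g 1 hgb
  -- expand (δ1)'s series by blocks of the `w`-lattice: `w = Lc•z + r`
  set EIv : Site (d + 1) → ℝ := fun w => ∑ b ∈ box (d + 1) Lc, ∑ s ∈ Finset.range Lc,
    (if P b s then colH G Lc l (toSite ρ) μ ((Lc : ℤ) • w + toSite b + (s : ℤ) • unitVec μ) else 0) with hEIv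
  have hEs : Summable fun w : Site (d + 1) => g (w μ) * EIv w := by
    have h1 : Summable fun w : Site (d + 1) => EIv w := by
      refine summable_sum fun b _ => summable_sum fun s _ => ?_
      by_cases h : P b s
      · simp only [if_pos h]
        -- `w ↦ colH(…)(Lc•w + b + s e)` : the affine family with `r = 0`, blocks of the `w`-lattice read as `Lc•(Lc•z' + r')`? use the finer decomposition directly:
        obtain ⟨δG, CG, hδG, hCG, hG⟩ := decays_coDressKBmAt_KInvStep (d := d) (ctrOff_mem_box (d := d + 1) hLc1) j
        have hc1 : Summable fun u : Site (d + 1) => colH G Lc l (toSite ρ) μ u :=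
          (summable_colH_mul_bdd (N := Lc) ⟨δG, CG, hδG, hCG, hG⟩ (T := fun _ => (1 : ℝ)) (B := 1) (fun _ => by simp) l (toSite ρ) μ).congr fun u => mul_one _
        have hL : (Lc : ℤ) ≠ 0 := by exact_mod_cast NeZero.ne Lc
        have hinj : Function.Injective fun w : Site (d + 1) => (Lc : ℤ) • w + toSite b + (s : ℤ) • unitVec μ := by
          intro w w' h
          have h' : (Lc : ℤ) • w = (Lc : ℤ) • w' := by
            have := congrArg (fun x => x - toSite b - (s : ℤ) • unitVec μ) h
            simpa using this
          funext i
          have := congrFun h' i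
          simp only [Pi.smul_apply, smul_eq_mul] at this
          exact mul_left_cancel₀ hL this
        exact hc1.comp_injective hinj
      · simp only [if_neg h]; exact summable_zero
    exact Summable.of_norm_bounded h1.abs (fun w => by
      rw [Real.norm_eq_abs, abs_mul]
      exact (mul_le_mul_of_nonneg_right (hgb _) (abs_nonneg _)).trans (by rw [one_mul]))
  have hkey : ∑' w : Site (d + 1), g (w μ) * EIv w = 0 := key
  rw [tsum_eq_sum_box_tsum (N := Lc) hEs] at hkey
  -- per box point `r`: the weight is `[r_μ = c]`
  have hval : ∀ r ∈ box (d + 1) Lc, ∀ z : Site (d + 1), g (((Lc : ℤ) • z + toSite r) μ) = if r μ = c then 1 else 0 := by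
    intro r hr z
    simp only [hg, emod_coarse_add_box z hr μ]
    by_cases h : r μ = c
    · rw [if_pos (by exact_mod_cast h), if_pos h]
    · rw [if_neg (fun h' => h (by exact_mod_cast h')), if_neg h]
  have e3 : (∑ r ∈ box (d + 1) Lc, ∑' z : Site (d + 1), g (((Lc : ℤ) • z + toSite r) μ) * EIv ((Lc : ℤ) • z + toSite r))
      = ∑ r ∈ (box (d + 1) Lc).filter (fun r => r μ = c), ∑' z : Site (d + 1), EIv ((Lc : ℤ) • z + toSite r) := by
    rw [Finset.sum_filter]
    refine Finset.sum_congr rfl fun r hr => ?_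
    by_cases h : r μ = c
    · rw [if_pos h]; exact tsum_congr fun z => by rw [hval r hr z, if_pos h, one_mul]
    · rw [if_neg h]
      have hz : (fun z : Site (d + 1) => g (((Lc : ℤ) • z + toSite r) μ) * EIv ((Lc : ℤ) • z + toSite r)) = fun _ => 0 := by
        funext z; rw [hval r hr z, if_neg h, zero_mul]
      rw [hz, tsum_zero]
  have hkey' : ∑ r ∈ (box (d + 1) Lc).filter (fun r => r μ = c), ∑' z : Site (d + 1), EIv ((Lc : ℤ) • z + toSite r) = 0 := by
    rw [← e3]; exact hkey
  -- the goal's series equals `Σ_{r∈filter} Σ'_z EIv (Lc•z + r)`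
  have hXE : ∀ (z : Site (d + 1)) r, (∑ b ∈ box (d + 1) Lc, ∑ s ∈ Finset.range Lc, X l r b s (toSite ρ) z) = EIv ((Lc : ℤ) • z + toSite r) := by
    intro z r
    simp only [hX, hEIv, hpt]
  have hzs : ∀ r, Summable fun z : Site (d + 1) => EIv ((Lc : ℤ) • z + toSite r) := by
    intro r
    have : Summable fun z : Site (d + 1) => ∑ b ∈ box (d + 1) Lc, ∑ s ∈ Finset.range Lc, X l r b s (toSite ρ) z := by
      refine summable_sum fun b _ => summable_sum fun s _ => ?_
      by_cases h : P b s
      · simp only [hX, if_pos h, hpt]; exact summable_shift_colH j l μ (toSite ρ) r b s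
      · simp only [hX, if_neg h]; exact summable_zero
    exact this.congr fun z => hXE z r
  have egoal : (∑' z : Site (d + 1), ∑ r ∈ (box (d + 1) Lc).filter (fun r => r μ = c), ∑ b ∈ box (d + 1) Lc, ∑ s ∈ Finset.range Lc, X l r b s (toSite ρ) z)
      = ∑ r ∈ (box (d + 1) Lc).filter (fun r => r μ = c), ∑' z : Site (d + 1), EIv ((Lc : ℤ) • z + toSite r) := by
    have e2 : ∀ z : Site (d + 1), (∑ r ∈ (box (d + 1) Lc).filter (fun r => r μ = c), ∑ b ∈ box (d + 1) Lc, ∑ s ∈ Finset.range Lc, X l r b s (toSite ρ) z)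
        = ∑ r ∈ (box (d + 1) Lc).filter (fun r => r μ = c), EIv ((Lc : ℤ) • z + toSite r) := by
      intro z
      exact Finset.sum_congr rfl fun r _ => hXE z r
    rw [tsum_congr e2, Summable.tsum_finsetSum (fun r _ => hzs r)]
  rw [egoal, hkey', mul_zero]

/-- NOT IN PRINT; OUR BOOKKEEPING.  **THE END-INSIDE FACE SUMS OF `H_j n` VANISH FOR BLOCK-PERIODIC `n`** (`Lc` odd, centred root, every `j`; `n` bounded and `Lc`-periodic; every `μ`, `Y`,
`c < Lc`): `Σ_{r∈box, r_μ=c} EI_{Lc}(H_j n) μ (Lc•Y + r) = 0`, `H_j n μ u = Σ_l Σ'_t n l t·colH G_j Lc l t μ u` written inline. -/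
theorem periodic_faceSum_EI_eq_zero (hLc : Odd Lc) (j : ℕ) {n : Form1 (d + 1) ℝ} {Bn : ℝ} (hnB : ∀ l t, |n l t| ≤ Bn)
    (hper : ∀ (l : Fin (d + 1)) (t z : Site (d + 1)), n l (t + (Lc : ℤ) • z) = n l t) (μ : Fin (d + 1)) (Y : Site (d + 1)) (c : ℕ) :
    ∑ r ∈ (box (d + 1) Lc).filter (fun r => r μ = c), ∑ b ∈ box (d + 1) Lc, ∑ s ∈ Finset.range Lc,
      (if b μ + s + 1 < Lc then
        (∑ l, ∑' t : Site (d + 1), n l t * colH (coDressKBmAt (toSite (ctrOff (d + 1) Lc)) Lc (KInvStep (d := d) Lc j)) Lc l t μ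
          ((Lc : ℤ) • ((Lc : ℤ) • Y + toSite r) + toSite b + (s : ℤ) • unitVec μ)) else 0) = 0 := by
  classical
  exact periodic_faceSum_eq_zero_of_blockWeight j hnB hper μ Y c (fun b s => b μ + s + 1 < Lc)
    (fun l ρ g B hg => tsum_blockWeight_mul_EI_colH_eq_zero hLc j l μ (toSite ρ) g hg)

/-- NOT IN PRINT; OUR BOOKKEEPING.  **THE BASE-OUTSIDE FACE SUMS OF `H_j n` VANISH FOR BLOCK-PERIODIC `n`**: `Σ_{r∈box, r_μ=c} BO_{Lc}(H_j n) μ (Lc•Y + r) = 0` (same hypotheses). -/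
theorem periodic_faceSum_BO_eq_zero (hLc : Odd Lc) (j : ℕ) {n : Form1 (d + 1) ℝ} {Bn : ℝ} (hnB : ∀ l t, |n l t| ≤ Bn)
    (hper : ∀ (l : Fin (d + 1)) (t z : Site (d + 1)), n l (t + (Lc : ℤ) • z) = n l t) (μ : Fin (d + 1)) (Y : Site (d + 1)) (c : ℕ) :
    ∑ r ∈ (box (d + 1) Lc).filter (fun r => r μ = c), ∑ b ∈ box (d + 1) Lc, ∑ s ∈ Finset.range Lc,
      (if Lc ≤ b μ + s then
        (∑ l, ∑' t : Site (d + 1), n l t * colH (coDressKBmAt (toSite (ctrOff (d + 1) Lc)) Lc (KInvStep (d := d) Lc j)) Lc l t μ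
          ((Lc : ℤ) • ((Lc : ℤ) • Y + toSite r) + toSite b + (s : ℤ) • unitVec μ)) else 0) = 0 := by
  classical
  exact periodic_faceSum_eq_zero_of_blockWeight j hnB hper μ Y c (fun b s => Lc ≤ b μ + s)
    (fun l ρ g B hg => tsum_blockWeight_mul_BO_colH_eq_zero hLc j l μ (toSite ρ) g hg)

end Summit.QuantumFields.BalabanUV.Beta.GAN24.PeriodicDataFaceSums

end
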